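import Literature.NumberTheory.LFunctions.Zhang2022.MainTermFormH1

/-!
# The polar form of `𝔅` and the Cauchy–Schwarz inequality on `H¹` profiles

Companion to `MainTermFormPSD` / `MainTermFormH1` (repair cell `pub-zhang`, audit + repair census of
Y. Zhang, *Discrete mean estimates and the Landau–Siegel zero*, arXiv:2211.02515 (2022)
[Zhang2022LandauSiegel]; the cell's verdict on that manuscript is NEGATIVE — the printed inequality
(8.24) fails, `Zhang2022.not_ineq824` — and this file makes no claim about its Theorems 1–2 and no
claim about Landau–Siegel zeros).

`MainTermFormH1.mainTermForm_nonneg_of_isH1` proves that the glued main-term form `𝔅(g,g)`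
(`mainTermForm`, closed form `mainTermForm_eq` = STRUCTURE.md (4.1) of the cell) is `≥ 0` on every
`H¹` profile. The cell's ALT seat 2 (alternative mollifier lengths / smoothings / extra pieces:
`b2b-zhang-alt-2/ALT-2.md`) reduces EVERY such design variant to one inequality: at main order the
final step of §2 needs `|𝔡′+𝔡|² > C₂₃₂·C₂₃₃` (`Section2MainOrder.MainOrderContradiction`,
`Section2Assembly.EndgameData.false_of_closing`), and in the cell's dictionary (lead g2,
`b2b-zhang-lead/g2/STRUCTURE.md` §§0, 4, 6: `Ξ₁ = 𝔅(𝔤,𝔤)𝔞𝔓`, `Ξ_J = 𝔅(f,f)𝔞𝔓`,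
`Ξ₁* = 𝔅(𝔤,f)𝔞𝔓` at main order) the three constants of a design `(𝔤, f)` — `𝔤` the glued
`H`-profile, `f` the `J`-profile — are `C₂₃₂ = 𝔅(𝔤,𝔤)`, `C₂₃₃ = 𝔅(f,f)` and `𝔡′+𝔡 = 𝔅(𝔤,f)`, the
POLAR form. This file supplies the
abstract half of that verdict, for all `H¹` profiles at once:

* `mainTermFormSesq u u′ v v′` — the sesquilinear form obtained from the six terms of (4.1) by
  polarisation (linear in `u`, conjugate-linear in `v`), and `mainTermFormPolar` — its Hermitian
  part `P(u,v) = (s(u,v) + conj s(v,u))/2`; `mainTermFormSesq_self_re`, `mainTermFormPolar_self`: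
  `P(g,g) = 𝔅(g,g)`; `mainTermFormPolar_swap`: `P(v,u) = conj P(u,v)`.
* `IsH1OnUnitInterval.add_smul` — `H¹` profiles form a complex vector space;
  `mainTermFormSesq_add_smul_left/right` — sesquilinearity (the integrability bookkeeping:
  `L² × L² ⊂ L¹` for the `g′ḡ′` term, `L¹ × C⁰` for the others).
* `mainTermForm_add_smul` — **the polarisation identity**
  `𝔅(u + t f) = 𝔅(u) + 2 Re( conj t · P(u,f)) + |t|² 𝔅(f)` (`t ∈ ℂ`).
* `norm_sq_mainTermFormPolar_le` — **Cauchy–Schwarz**: `|P(u,f)|² ≤ 𝔅(u,u)·𝔅(f,f)` for `H¹`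
  profiles (from `𝔅 ≥ 0` on the line `u − rP·f`, `discrim_le_zero`);
  `norm_mainTermFormPolar_le_sqrt`: `|P(u,f)| ≤ √(𝔅(u,u)𝔅(f,f))`;
  `norm_sq_mainTermFormPolar_div_le`: the variational form `|P(𝔤,f)|²/𝔅(𝔤,𝔤) ≤ 𝔅(f,f)`
  ("`T_opt(d) ≤ C_J(d)`" of ALT-2, for one `𝔤`; the design optimum is its supremum over the span).
* `le_sqrt_of_mainTerm_thresholds`, `not_closing_of_isH1` — the §2 shape: whenever
  `𝔅(𝔤,𝔤) ≤ q`, `𝔅(f,f) ≤ c_J` and `d ≤ |P(𝔤,f)|`, then `d ≤ √(q·c_J)`, i.e. the closing condition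
  `√(q·c_J) < d` of `EndgameData.false_of_closing` (with `ε → 0`) is unattainable by main-order
  constants of this provenance — for ANY pair of `H¹` profiles, printed or not.

What is NOT here (and is the cell's STRUCTURE.md §4, kernel-checked only for the printed family in
`Section2AllIota.normSq_dsumG_le_c`): the identification of the manuscript's (2.18)/(10.17) cross
main term `𝔡′+𝔡` of a general admissible design with `P(𝔤,f)`. All declarations are elementary and
tagged `[folklore]`.
-/

noncomputable section

open MeasureTheory Set intervalIntegral
open scoped Real ComplexConjugate

namespace Literature.NumberTheory.LFunctions.Zhang2022

/-! ### The sesquilinear and polar forms -/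

/-- The sesquilinear form behind (4.1): linear in `(u,u′)`, conjugate-linear in `(v,v′)`, with
`Re s(g,g) = 𝔅(g,g)` (`mainTermFormSesq_self_re`):
`s = (8/π)⟨u′,v′⟩ − 48i⟨u′,v⟩ + 88π⟨u,v⟩ − 48π²i⟨u,S_v⟩ − 24π conj(S_v(1))(u(0)+u(1)) − 16i u(0)conj(v(1))`,
`⟨a,b⟩ = ∫₀¹ a b̄`, `S_v(x) = ∫₀ˣ v`. [folklore] -/
def mainTermFormSesq (u u' v v' : ℝ → ℂ) : ℂ :=
  ((8 / π : ℝ) : ℂ) * (∫ x in (0:ℝ)..1, u' x * conj (v' x))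
    - ((48 : ℝ) : ℂ) * Complex.I * (∫ x in (0:ℝ)..1, u' x * conj (v x))
    + ((88 * π : ℝ) : ℂ) * (∫ x in (0:ℝ)..1, u x * conj (v x))
    - ((48 * π ^ 2 : ℝ) : ℂ) * Complex.I *
        (∫ x in (0:ℝ)..1, u x * conj (∫ t in (0:ℝ)..x, v t))
    - ((24 * π : ℝ) : ℂ) * (conj (∫ t in (0:ℝ)..1, v t) * (u 0 + u 1))
    - ((16 : ℝ) : ℂ) * Complex.I * (u 0 * conj (v 1))

/-- **The polar (Hermitian) form `P(u,v)` of `𝔅`**: `P = (s(u,v) + conj s(v,u))/2`. [folklore] -/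
def mainTermFormPolar (u u' v v' : ℝ → ℂ) : ℂ :=
  (mainTermFormSesq u u' v v' + conj (mainTermFormSesq v v' u u')) / 2

variable {u u' v v' f f' g g' : ℝ → ℂ}

/-- `∫₀¹ h h̄ = ∫₀¹ ‖h‖²` (as a complex number). [folklore] -/
theorem intervalIntegral_mul_conj_self (h : ℝ → ℂ) :
    (∫ x in (0:ℝ)..1, h x * conj (h x)) = ((∫ x in (0:ℝ)..1, ‖h x‖ ^ 2 : ℝ) : ℂ) := by
  rw [← intervalIntegral.integral_ofReal]
  refine intervalIntegral.integral_congr fun x _ => ?_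
  simp only [Complex.mul_conj']
  push_cast
  rfl

/-- `Re s(g,g) = 𝔅(g,g)` (no hypothesis on `g`: both sides are the same six terms). [folklore] -/
theorem mainTermFormSesq_self_re (g g' : ℝ → ℂ) :
    (mainTermFormSesq g g' g g').re = mainTermForm g g' := by
  rw [mainTermForm_eq, mainTermFormSesq, intervalIntegral_mul_conj_self g',
    intervalIntegral_mul_conj_self g]
  simp only [Complex.add_re, Complex.sub_re, Complex.mul_re, Complex.mul_im, Complex.ofReal_re,
    Complex.ofReal_im, Complex.I_re, Complex.I_im, Complex.conj_re, Complex.conj_im,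
    Complex.add_im]
  ring

/-- `P(g,g) = 𝔅(g,g)`. [folklore] -/
theorem mainTermFormPolar_self (g g' : ℝ → ℂ) :
    mainTermFormPolar g g' g g' = (mainTermForm g g' : ℂ) := by
  rw [mainTermFormPolar, ← mainTermFormSesq_self_re, Complex.add_conj]
  push_cast
  ring

/-- Hermitian symmetry `P(v,u) = conj P(u,v)`. [folklore] -/
theorem mainTermFormPolar_swap (u u' v v' : ℝ → ℂ) :
    mainTermFormPolar v v' u u' = conj (mainTermFormPolar u u' v v') := by
  simp only [mainTermFormPolar, map_div₀, map_add, Complex.conj_conj, Complex.conj_ofNat, add_comm]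

/-- `Re(conj t · s(u,f) + t · s(f,u)) = 2 Re(conj t · P(u,f))`. [folklore] -/
theorem re_cross_eq_two_re_polar (t a b : ℂ) :
    (conj t * a + t * b).re = 2 * (conj t * ((a + conj b) / 2)).re := by
  simp only [Complex.add_re, Complex.mul_re, Complex.conj_re, Complex.conj_im, Complex.div_ofNat_re,
    Complex.add_im, Complex.div_ofNat_im]
  ring

/-! ### `H¹` profiles form a vector space; integrability bookkeeping -/

namespace IsH1OnUnitInterval

/-- `u + t f ∈ H¹` with derivative `u′ + t f′`. [folklore] -/
theorem add_smul (hu : IsH1OnUnitInterval u u') (hf : IsH1OnUnitInterval f f') (t : ℂ) :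
    IsH1OnUnitInterval (fun x => u x + t * f x) (fun x => u' x + t * f' x) where
  memLp := hu.memLp.add (hf.memLp.const_mul t)
  eq_add_integral := fun y hy => by
    have iu := intervalIntegrable_mono_unit hu.intervalIntegrable hy
    have ifl := intervalIntegrable_mono_unit hf.intervalIntegrable hy
    rw [intervalIntegral.integral_add iu (ifl.const_mul t), intervalIntegral.integral_const_mul,
      hu.eq_add_integral y hy, hf.eq_add_integral y hy]
    ring

/-- `conj g′ ∈ L²(0,1)`. [folklore] -/
theorem memLp_conj (hg : IsH1OnUnitInterval g g') :
    MemLp (fun x => conj (g' x)) 2 (volume.restrict (Ioc (0:ℝ) 1)) :=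
  (Complex.conjCLE.toContinuousLinearMap).comp_memLp' hg.memLp

/-- `u′ · conj v′` is integrable on `[0,1]` (`L² × L² ⊂ L¹`). [folklore] -/
theorem intervalIntegrable_deriv_mul_conj_deriv (hu : IsH1OnUnitInterval u u')
    (hv : IsH1OnUnitInterval v v') :
    IntervalIntegrable (fun x => u' x * conj (v' x)) volume 0 1 := by
  rw [intervalIntegrable_iff, uIoc_of_le zero_le_one]
  exact hu.memLp.integrable_mul hv.memLp_conj

/-- `u′ · conj v` is integrable on `[0,1]` (`L¹ × C⁰`). [folklore] -/
theorem intervalIntegrable_deriv_mul_conj (hu : IsH1OnUnitInterval u u')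
    (hv : IsH1OnUnitInterval v v') :
    IntervalIntegrable (fun x => u' x * conj (v x)) volume 0 1 :=
  hu.intervalIntegrable.mul_continuousOn
    (by rw [uIcc_of_le zero_le_one]; exact continuousOn_conj_comp hv.continuousOn)

/-- `u · conj v` is integrable on `[0,1]`. [folklore] -/
theorem intervalIntegrable_mul_conj (hu : IsH1OnUnitInterval u u')
    (hv : IsH1OnUnitInterval v v') :
    IntervalIntegrable (fun x => u x * conj (v x)) volume 0 1 :=
  (hu.continuousOn.mul (continuousOn_conj_comp hv.continuousOn)).intervalIntegrable_of_Icc zero_le_one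

/-- `u · conj S_v` is integrable on `[0,1]`, `S_v(x) = ∫₀ˣ v`. [folklore] -/
theorem intervalIntegrable_mul_conj_primitive (hu : IsH1OnUnitInterval u u')
    (hv : IsH1OnUnitInterval v v') :
    IntervalIntegrable (fun x => u x * conj (∫ t in (0:ℝ)..x, v t)) volume 0 1 :=
  (hu.continuousOn.mul
    (continuousOn_conj_comp (continuousOn_primitive_unit hv.continuousOn))).intervalIntegrable_of_Icc
    zero_le_one

/-- `S_{v + t f} = S_v + t S_f` on `[0,1]`. [folklore] -/
theorem primitive_add_smul (hv : IsH1OnUnitInterval v v') (hf : IsH1OnUnitInterval f f') (t : ℂ)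
    {x : ℝ} (hx : x ∈ Icc (0:ℝ) 1) :
    (∫ s in (0:ℝ)..x, (v s + t * f s)) = (∫ s in (0:ℝ)..x, v s) + t * ∫ s in (0:ℝ)..x, f s := by
  have iv : IntervalIntegrable v volume 0 x :=
    (hv.continuousOn.mono (Icc_subset_Icc_right hx.2)).intervalIntegrable_of_Icc hx.1
  have ifx : IntervalIntegrable f volume 0 x :=
    (hf.continuousOn.mono (Icc_subset_Icc_right hx.2)).intervalIntegrable_of_Icc hx.1
  rw [intervalIntegral.integral_add iv (ifx.const_mul t), intervalIntegral.integral_const_mul]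

end IsH1OnUnitInterval

/-! ### Sesquilinearity -/

/-- Linearity of `s` in the first argument (on `H¹`). [folklore] -/
theorem mainTermFormSesq_add_smul_left (hu : IsH1OnUnitInterval u u')
    (hf : IsH1OnUnitInterval f f') (hv : IsH1OnUnitInterval v v') (t : ℂ) :
    mainTermFormSesq (fun x => u x + t * f x) (fun x => u' x + t * f' x) v v'
      = mainTermFormSesq u u' v v' + t * mainTermFormSesq f f' v v' := by
  have e1 : (∫ x in (0:ℝ)..1, (u' x + t * f' x) * conj (v' x))
      = (∫ x in (0:ℝ)..1, u' x * conj (v' x)) + t * ∫ x in (0:ℝ)..1, f' x * conj (v' x) := by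
    rw [← intervalIntegral.integral_const_mul, ← intervalIntegral.integral_add
      (hu.intervalIntegrable_deriv_mul_conj_deriv hv)
      ((hf.intervalIntegrable_deriv_mul_conj_deriv hv).const_mul t)]
    exact intervalIntegral.integral_congr fun x _ => by ring
  have e2 : (∫ x in (0:ℝ)..1, (u' x + t * f' x) * conj (v x))
      = (∫ x in (0:ℝ)..1, u' x * conj (v x)) + t * ∫ x in (0:ℝ)..1, f' x * conj (v x) := by
    rw [← intervalIntegral.integral_const_mul, ← intervalIntegral.integral_add
      (hu.intervalIntegrable_deriv_mul_conj hv)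
      ((hf.intervalIntegrable_deriv_mul_conj hv).const_mul t)]
    exact intervalIntegral.integral_congr fun x _ => by ring
  have e3 : (∫ x in (0:ℝ)..1, (u x + t * f x) * conj (v x))
      = (∫ x in (0:ℝ)..1, u x * conj (v x)) + t * ∫ x in (0:ℝ)..1, f x * conj (v x) := by
    rw [← intervalIntegral.integral_const_mul, ← intervalIntegral.integral_add
      (hu.intervalIntegrable_mul_conj hv) ((hf.intervalIntegrable_mul_conj hv).const_mul t)]
    exact intervalIntegral.integral_congr fun x _ => by ring
  have e4 : (∫ x in (0:ℝ)..1, (u x + t * f x) * conj (∫ s in (0:ℝ)..x, v s))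
      = (∫ x in (0:ℝ)..1, u x * conj (∫ s in (0:ℝ)..x, v s))
        + t * ∫ x in (0:ℝ)..1, f x * conj (∫ s in (0:ℝ)..x, v s) := by
    rw [← intervalIntegral.integral_const_mul, ← intervalIntegral.integral_add
      (hu.intervalIntegrable_mul_conj_primitive hv)
      ((hf.intervalIntegrable_mul_conj_primitive hv).const_mul t)]
    exact intervalIntegral.integral_congr fun x _ => by ring
  simp only [mainTermFormSesq]
  rw [e1, e2, e3, e4]
  ring

/-- Conjugate-linearity of `s` in the second argument (on `H¹`). [folklore] -/
theorem mainTermFormSesq_add_smul_right (hu : IsH1OnUnitInterval u u')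
    (hv : IsH1OnUnitInterval v v') (hf : IsH1OnUnitInterval f f') (t : ℂ) :
    mainTermFormSesq u u' (fun x => v x + t * f x) (fun x => v' x + t * f' x)
      = mainTermFormSesq u u' v v' + conj t * mainTermFormSesq u u' f f' := by
  have e1 : (∫ x in (0:ℝ)..1, u' x * conj (v' x + t * f' x))
      = (∫ x in (0:ℝ)..1, u' x * conj (v' x)) + conj t * ∫ x in (0:ℝ)..1, u' x * conj (f' x) := by
    rw [← intervalIntegral.integral_const_mul, ← intervalIntegral.integral_add
      (hu.intervalIntegrable_deriv_mul_conj_deriv hv)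
      ((hu.intervalIntegrable_deriv_mul_conj_deriv hf).const_mul (conj t))]
    exact intervalIntegral.integral_congr fun x _ => by simp only [map_add, map_mul]; ring
  have e2 : (∫ x in (0:ℝ)..1, u' x * conj (v x + t * f x))
      = (∫ x in (0:ℝ)..1, u' x * conj (v x)) + conj t * ∫ x in (0:ℝ)..1, u' x * conj (f x) := by
    rw [← intervalIntegral.integral_const_mul, ← intervalIntegral.integral_add
      (hu.intervalIntegrable_deriv_mul_conj hv)
      ((hu.intervalIntegrable_deriv_mul_conj hf).const_mul (conj t))]
    exact intervalIntegral.integral_congr fun x _ => by simp only [map_add, map_mul]; ring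
  have e3 : (∫ x in (0:ℝ)..1, u x * conj (v x + t * f x))
      = (∫ x in (0:ℝ)..1, u x * conj (v x)) + conj t * ∫ x in (0:ℝ)..1, u x * conj (f x) := by
    rw [← intervalIntegral.integral_const_mul, ← intervalIntegral.integral_add
      (hu.intervalIntegrable_mul_conj hv) ((hu.intervalIntegrable_mul_conj hf).const_mul (conj t))]
    exact intervalIntegral.integral_congr fun x _ => by simp only [map_add, map_mul]; ring
  have e4 : (∫ x in (0:ℝ)..1, u x * conj (∫ s in (0:ℝ)..x, (v s + t * f s)))
      = (∫ x in (0:ℝ)..1, u x * conj (∫ s in (0:ℝ)..x, v s))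
        + conj t * ∫ x in (0:ℝ)..1, u x * conj (∫ s in (0:ℝ)..x, f s) := by
    rw [← intervalIntegral.integral_const_mul, ← intervalIntegral.integral_add
      (hu.intervalIntegrable_mul_conj_primitive hv)
      ((hu.intervalIntegrable_mul_conj_primitive hf).const_mul (conj t))]
    refine intervalIntegral.integral_congr fun x hx => ?_
    rw [uIcc_of_le zero_le_one] at hx
    simp only [hv.primitive_add_smul hf t hx, map_add, map_mul]
    ring
  have e5 : (∫ s in (0:ℝ)..1, (v s + t * f s)) = (∫ s in (0:ℝ)..1, v s) + t * ∫ s in (0:ℝ)..1, f s :=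
    hv.primitive_add_smul hf t (right_mem_Icc.2 zero_le_one)
  simp only [mainTermFormSesq]
  rw [e1, e2, e3, e4, e5]
  simp only [map_add, map_mul]
  ring

/-! ### Polarisation identity and Cauchy–Schwarz -/

/-- **Polarisation identity**: `𝔅(u + t f) = 𝔅(u) + 2 Re(conj t · P(u,f)) + |t|² 𝔅(f)` for `H¹`
profiles `u, f` and `t ∈ ℂ`. [folklore] -/
theorem mainTermForm_add_smul (hu : IsH1OnUnitInterval u u') (hf : IsH1OnUnitInterval f f')
    (t : ℂ) :
    mainTermForm (fun x => u x + t * f x) (fun x => u' x + t * f' x)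
      = mainTermForm u u' + 2 * (conj t * mainTermFormPolar u u' f f').re
        + ‖t‖ ^ 2 * mainTermForm f f' := by
  have huf := hu.add_smul hf t
  rw [← mainTermFormSesq_self_re, ← mainTermFormSesq_self_re u u', ← mainTermFormSesq_self_re f f',
    mainTermFormSesq_add_smul_left hu hf huf t, mainTermFormSesq_add_smul_right hu hu hf t,
    mainTermFormSesq_add_smul_right hf hu hf t, mainTermFormPolar]
  have ht : t * conj t = ((‖t‖ ^ 2 : ℝ) : ℂ) := by rw [Complex.mul_conj']; push_cast; rfl
  have key : (mainTermFormSesq u u' u u' + conj t * mainTermFormSesq u u' f f'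
        + t * (mainTermFormSesq f f' u u' + conj t * mainTermFormSesq f f' f f')).re
      = (mainTermFormSesq u u' u u').re
        + (conj t * mainTermFormSesq u u' f f' + t * mainTermFormSesq f f' u u').re
        + (((‖t‖ ^ 2 : ℝ) : ℂ) * mainTermFormSesq f f' f f').re := by
    rw [← ht]; simp only [Complex.add_re, mul_add, ← mul_assoc]; ring
  rw [key, re_cross_eq_two_re_polar, Complex.re_ofReal_mul]

/-- **Cauchy–Schwarz for the main-term form on `H¹`**: `|P(u,f)|² ≤ 𝔅(u,u)·𝔅(f,f)`. [folklore] -/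
theorem norm_sq_mainTermFormPolar_le (hu : IsH1OnUnitInterval u u')
    (hf : IsH1OnUnitInterval f f') :
    ‖mainTermFormPolar u u' f f'‖ ^ 2 ≤ mainTermForm u u' * mainTermForm f f' := by
  set P := mainTermFormPolar u u' f f' with hP
  have hBu := mainTermForm_nonneg_of_isH1 hu
  have hBf := mainTermForm_nonneg_of_isH1 hf
  -- `𝔅(u − rP·f) = ‖P‖²𝔅(f)·r² − 2‖P‖²·r + 𝔅(u) ≥ 0` for every real `r`
  have hquad : ∀ r : ℝ, 0 ≤ (‖P‖ ^ 2 * mainTermForm f f') * (r * r) + (-(2 * ‖P‖ ^ 2)) * r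
      + mainTermForm u u' := by
    intro r
    have h := mainTermForm_nonneg_of_isH1 (hu.add_smul hf (-(r : ℂ) * P))
    rw [mainTermForm_add_smul hu hf] at h
    have h1 : (conj (-(r : ℂ) * P) * P).re = -(r * ‖P‖ ^ 2) := by
      have e : conj (-(r : ℂ) * P) * P = -((r * ‖P‖ ^ 2 : ℝ) : ℂ) := by
        rw [map_mul, map_neg, Complex.conj_ofReal, mul_assoc, Complex.conj_mul']
        push_cast; ring
      rw [e, Complex.neg_re, Complex.ofReal_re]
    have h2 : ‖-(r : ℂ) * P‖ ^ 2 = r ^ 2 * ‖P‖ ^ 2 := by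
      rw [norm_mul, norm_neg, Complex.norm_real, mul_pow, Real.norm_eq_abs, sq_abs]
    rw [h1, h2] at h
    nlinarith [h]
  have hdisc := discrim_le_zero hquad
  rw [discrim] at hdisc
  -- `4‖P‖⁴ − 4‖P‖²𝔅(f)𝔅(u) ≤ 0`
  by_cases hP0 : ‖P‖ ^ 2 = 0
  · rw [hP0]; exact mul_nonneg hBu hBf
  · have hpos : 0 < ‖P‖ ^ 2 := lt_of_le_of_ne (sq_nonneg _) (Ne.symm hP0)
    have h3 : ‖P‖ ^ 2 * ‖P‖ ^ 2 ≤ ‖P‖ ^ 2 * (mainTermForm u u' * mainTermForm f f') := by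
      nlinarith [hdisc]
    exact le_of_mul_le_mul_left h3 hpos

/-- `|P(u,f)| ≤ √(𝔅(u,u)·𝔅(f,f))`. [folklore] -/
theorem norm_mainTermFormPolar_le_sqrt (hu : IsH1OnUnitInterval u u')
    (hf : IsH1OnUnitInterval f f') :
    ‖mainTermFormPolar u u' f f'‖ ≤ Real.sqrt (mainTermForm u u' * mainTermForm f f') := by
  rw [← Real.sqrt_sq (norm_nonneg (mainTermFormPolar u u' f f'))]
  exact Real.sqrt_le_sqrt (norm_sq_mainTermFormPolar_le hu hf)

/-- The variational form ("`T_opt ≤ C_J`" of the cell's ALT-2 census, one direction `𝔤` at a time):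
`|P(𝔤,f)|² / 𝔅(𝔤,𝔤) ≤ 𝔅(f,f)`. (For `𝔅(𝔤,𝔤) = 0` the left side is `0` by convention.) [folklore] -/
theorem norm_sq_mainTermFormPolar_div_le (hg : IsH1OnUnitInterval g g')
    (hf : IsH1OnUnitInterval f f') :
    ‖mainTermFormPolar g g' f f'‖ ^ 2 / mainTermForm g g' ≤ mainTermForm f f' := by
  rcases (mainTermForm_nonneg_of_isH1 hg).eq_or_lt with h0 | hpos
  · rw [← h0, div_zero]; exact mainTermForm_nonneg_of_isH1 hf
  · rw [div_le_iff₀ hpos, mul_comm]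
    exact norm_sq_mainTermFormPolar_le hg hf

/-! ### The shape consumed by §2 of the manuscript -/

/-- **Main-order thresholds of polar provenance never close the final step of §2.** If for `H¹`
profiles `𝔤` (glued `H`-side) and `f` (`J`-side) the three main-order constants satisfy
`𝔅(𝔤,𝔤) ≤ q` ((2.32)-type upper bound), `𝔅(f,f) ≤ c_J` ((2.33)-type upper bound) and
`d ≤ |P(𝔤,f)|` ((2.18)/Prop. 2.4-type lower bound), then `d ≤ √(q·c_J)`. [folklore] -/
theorem le_sqrt_of_mainTerm_thresholds (hg : IsH1OnUnitInterval g g')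
    (hf : IsH1OnUnitInterval f f') {q cJ d : ℝ} (hq : mainTermForm g g' ≤ q)
    (hcJ : mainTermForm f f' ≤ cJ) (hd : d ≤ ‖mainTermFormPolar g g' f f'‖) :
    d ≤ Real.sqrt (q * cJ) := by
  refine hd.trans ((norm_mainTermFormPolar_le_sqrt hg hf).trans (Real.sqrt_le_sqrt ?_))
  exact mul_le_mul hq hcJ (mainTermForm_nonneg_of_isH1 hf)
    ((mainTermForm_nonneg_of_isH1 hg).trans hq)

/-- Hence the closing condition `√(q·c_J) < d` of `Section2Assembly.EndgameData.false_of_closing`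
(at `ε = 0`; `Section2MainOrder.MainOrderContradiction` is the printed instance) FAILS for every
pair of `H¹` profiles and every such triple of thresholds: no choice of lengths, smoothings or extra
pieces inside the class changes this (the cell's ALT-2 census, theorem T-ALT2.CS). [folklore] -/
theorem not_closing_of_isH1 (hg : IsH1OnUnitInterval g g') (hf : IsH1OnUnitInterval f f')
    {q cJ d : ℝ} (hq : mainTermForm g g' ≤ q) (hcJ : mainTermForm f f' ≤ cJ)
    (hd : d ≤ ‖mainTermFormPolar g g' f f'‖) : ¬ (Real.sqrt (q * cJ) < d) :=
  not_lt.2 (le_sqrt_of_mainTerm_thresholds hg hf hq hcJ hd)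

/-- The same for kinked profiles given by right derivatives (the form in which the cell's profiles —
continuous, piecewise poly×exp — are presented; cf. `mainTermForm_nonneg_of_hasDerivWithinAt_Ioi`).
[folklore] -/
theorem norm_sq_mainTermFormPolar_le_of_hasDerivWithinAt_Ioi
    (hgc : ContinuousOn g (Icc 0 1)) (hgd : ∀ x ∈ Ioo (0:ℝ) 1, HasDerivWithinAt g (g' x) (Ioi x) x)
    (hgm : MemLp g' 2 (volume.restrict (Ioc (0:ℝ) 1)))
    (hfc : ContinuousOn f (Icc 0 1)) (hfd : ∀ x ∈ Ioo (0:ℝ) 1, HasDerivWithinAt f (f' x) (Ioi x) x)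
    (hfm : MemLp f' 2 (volume.restrict (Ioc (0:ℝ) 1))) :
    ‖mainTermFormPolar g g' f f'‖ ^ 2 ≤ mainTermForm g g' * mainTermForm f f' :=
  norm_sq_mainTermFormPolar_le (isH1_of_hasDerivWithinAt_Ioi hgc hgd hgm)
    (isH1_of_hasDerivWithinAt_Ioi hfc hfd hfm)

end Literature.NumberTheory.LFunctions.Zhang2022
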